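import Summits.QuantumFields.YangMills.Theorems.AllWindowsColdBoxBoxHighLineStep2Wick
import Summits.QuantumFields.YangMills.Theorems.AllWindowsColdBoxBoxHighLineEdgeChartGaussianMoments

/-!
# T-S5.13 parity bookkeeping — the Hodge Gaussian of the edge chart is EVEN, so odd observables average to zero
# («`c^{(2)}c^{(2)}V₃` odd ⇒ 0», ASSEMBLY-S5 §5–§6 (e3)/(e4))

Planner ym-idea-2 g18's `ASSEMBLY-S5.md` §5 («Parity: V₃ odd; W₄, U_Φ, U_Haar even; … D symmetric under a ↦ −a») and §6 (e3) («`Cov₀(linCurvSq₀, c_T^{odd}) = 0` by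
parity»), (e4) (odd × odd / even × even split of `f′(0)`).  Over the letters of ✓`…Step2Wick` this file supplies:

* §1 negation in the chart: `flatten_neg`, ★`integral_comp_neg_edgeField` (`∫ F(−a) da = ∫ F(a) da`, via the flat chart where Lebesgue measure is
  negation invariant);
* §2 parities of the STEP-2 letters: `boxQuadForm_neg`, `gaussWeight_neg` (even), `linCurv_neg` (odd), `linCurvSq_neg` (even), `divLin_neg`, `divLinSq_neg`,
  `chartPlaqCostOdd_neg` (odd), ★`cubicVertex_neg` (odd), ★`quarticWilson_neg` (even), `neg_mem_smallField_iff`, `sfInd_neg` (even);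
* §3 ★`gaussAvg_eq_zero_of_odd` (no integrability needed), `gaussAvg_mul_eq_zero_of_even_odd`, `gaussCov_eq_zero_of_even_odd`, and the named instances
  `gaussAvg_cubicVertex_eq_zero`, `gaussAvg_linCurvSq_mul_linCurvSq_mul_cubicVertex_eq_zero` (the 10-leg parity rule of the plan),
  `gaussCov_linCurvSq_chartPlaqCostOdd_eq_zero` ((e3)), `gaussAvg_sfInd_mul_eq_zero_of_odd` (restriction to the symmetric small-field set).

Tree (✓Step2Wick, ✓EdgeChartGaussianMoments) + Mathlib; no definitions.  HONEST LABEL: bookkeeping for the T-S5.13 assembly of the XL stub S5 of a critic-PASSed DRAFT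
line; T-S5.13/S5, U5, ⟨24004⟩ ⟨24335⟩ ⟨24336⟩ remain OPEN; route AllWindowsColdBox is DRAFT; no rung is proved; the Yang–Mills mass gap is NOT proved by this file.
Seat ym-line-sfw-p2 g77 (LEAD, cell ym-idea-1; T-S5.13 assembler of record).
-/

set_option autoImplicit false

noncomputable section

open MeasureTheory Matrix Finset
open Literature.Probability.LatticeModels (Site)
open Literature.MathematicalPhysics.QuantumLattice (ZdPlaquette plaquettesTouching)

namespace Summit.QuantumFields.YangMills.Theorems.AllWindowsColdBoxBoxHighLine

namespace EdgeChartGaussian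

open LaplaceSandwich (flatten flatten_apply volume_preserving_flatten)

/-! ## §1 Negation in the edge chart -/

/-- Flattening commutes with negation. -/
theorem flatten_neg {H : ℕ} (a : LandauFree H → E3) : flatten (LandauFree H) (-a) = -flatten (LandauFree H) a := by
  funext p; rfl

/-- ★ Lebesgue measure on the edge fields is invariant under `a ↦ −a`: `∫ F(−a) da = ∫ F(a) da` (no integrability needed). -/
theorem integral_comp_neg_edgeField {H : ℕ} (F : (LandauFree H → E3) → ℝ) :
    ∫ a : LandauFree H → E3, F (-a) = ∫ a : LandauFree H → E3, F a := by
  have h1 : ∀ a : LandauFree H → E3, F (-a) = (fun v : LandauFree H × Fin 3 → ℝ => F ((flatten (LandauFree H)).symm (-v))) (flatten (LandauFree H) a) := by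
    intro a
    simp only [← flatten_neg, MeasurableEquiv.symm_apply_apply]
  have h2 : ∀ a : LandauFree H → E3, F a = (fun v : LandauFree H × Fin 3 → ℝ => F ((flatten (LandauFree H)).symm v)) (flatten (LandauFree H) a) := by
    intro a
    simp only [MeasurableEquiv.symm_apply_apply]
  simp_rw [h1]
  rw [integral_eq_flat (I := LandauFree H) (fun v => F ((flatten (LandauFree H)).symm (-v))),
    integral_neg_eq_self (fun v => F ((flatten (LandauFree H)).symm v)) volume, ← integral_eq_flat (I := LandauFree H)]
  exact integral_congr_ae (Filter.Eventually.of_forall fun a => (h2 a).symm)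

/-! ## §2 Parities of the STEP-2 letters -/

variable {H : ℕ}

/-- `colour (−a) c = −colour a c`. -/
theorem colour_neg (a : LandauFree H → E3) (c : Fin 3) : colour (-a) c = -colour a c := by
  funext e; rfl

/-- The Hodge form is even. -/
theorem boxQuadForm_neg (a : LandauFree H → E3) : boxQuadForm H (-a) = boxQuadForm H a := by
  unfold boxQuadForm
  refine Finset.sum_congr rfl fun c _ => ?_
  rw [colour_neg, Matrix.mulVec_neg, dotProduct_neg, neg_dotProduct, neg_neg]

/-- The Gaussian weight is even. -/
theorem gaussWeight_neg (β : ℝ) (a : LandauFree H → E3) : gaussWeight β H (-a) = gaussWeight β H a := by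
  unfold gaussWeight; rw [boxQuadForm_neg]

/-- The linearised curvature is odd. -/
theorem linCurv_neg (p : Literature.MathematicalPhysics.QuantumFieldTheory.Plaq 4) (a : LandauFree H → E3) (c : Fin 3) :
    linCurv H p (-a) c = -linCurv H p a c := by
  unfold linCurv; rw [colour_neg, dotProduct_neg]

/-- `|ℓ_p|²` is even. -/
theorem linCurvSq_neg (p : Literature.MathematicalPhysics.QuantumFieldTheory.Plaq 4) (a : LandauFree H → E3) :
    linCurvSq H p (-a) = linCurvSq H p a := by
  unfold linCurvSq; simp only [linCurv_neg, neg_sq]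

/-- The linearised divergence is odd. -/
theorem divLin_neg (x : Site 4) (a : LandauFree H → E3) (c : Fin 3) : divLin H x (-a) c = -divLin H x a c := by
  unfold divLin; rw [colour_neg, dotProduct_neg]

/-- `Σ|(d*a)_x|²` is even. -/
theorem divLinSq_neg (a : LandauFree H → E3) : divLinSq H (-a) = divLinSq H a := by
  unfold divLinSq; simp only [divLin_neg, neg_sq]

/-- The odd part of the plaquette cost is odd. -/
theorem chartPlaqCostOdd_neg (x : Site 4) (μ ν : Fin 4) (a : LandauFree H → E3) :
    chartPlaqCostOdd H x μ ν (-a) = -chartPlaqCostOdd H x μ ν a := by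
  unfold chartPlaqCostOdd; rw [neg_neg]; ring

/-- ★ The cubic vertex is odd. -/
theorem cubicVertex_neg (β : ℝ) (a : LandauFree H → E3) : cubicVertex β H (-a) = -cubicVertex β H a := by
  unfold cubicVertex
  simp only [chartPlaqCostOdd_neg, Finset.sum_neg_distrib, mul_neg]

/-- ★ The even non-Gaussian Wilson part is even. -/
theorem quarticWilson_neg (β : ℝ) (a : LandauFree H → E3) : quarticWilson β H (-a) = quarticWilson β H a := by
  unfold quarticWilson
  refine congrArg (fun S : ℝ => β * S) (Finset.sum_congr rfl fun p _ => ?_)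
  rw [linCurvSq_neg]
  unfold chartPlaqCostOdd
  rw [neg_neg]
  ring

/-- The small-field set is symmetric. -/
theorem neg_mem_smallField_iff (s : ℝ) (a : LandauFree H → E3) : -a ∈ smallField H s ↔ a ∈ smallField H s := by
  simp only [smallField, Set.mem_setOf_eq, Pi.neg_apply, norm_neg]

/-- The small-field indicator is even. -/
theorem sfInd_neg (s : ℝ) (a : LandauFree H → E3) : sfInd H s (-a) = sfInd H s a := by
  unfold sfInd
  by_cases h : a ∈ smallField H s
  · rw [Set.indicator_of_mem h, Set.indicator_of_mem ((neg_mem_smallField_iff s a).2 h)]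
  · rw [Set.indicator_of_notMem h, Set.indicator_of_notMem (mt (neg_mem_smallField_iff s a).1 h)]

/-! ## §3 Odd observables have zero Gaussian average -/

/-- ★ **Parity rule**: an odd observable has `gaussAvg = 0` (no integrability hypothesis: both sides of `∫F w = −∫F w` are the same Bochner integral). -/
theorem gaussAvg_eq_zero_of_odd (β : ℝ) (H : ℕ) {F : (LandauFree H → E3) → ℝ} (hF : ∀ a, F (-a) = -F a) : gaussAvg β H F = 0 := by
  unfold gaussAvg
  have h : (∫ a : LandauFree H → E3, F a * gaussWeight β H a) = ∫ a : LandauFree H → E3, F (-a) * gaussWeight β H (-a) :=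
    (integral_comp_neg_edgeField (fun a => F a * gaussWeight β H a)).symm
  have h2 : (fun a : LandauFree H → E3 => F (-a) * gaussWeight β H (-a)) = fun a => -(F a * gaussWeight β H a) := by
    funext a; rw [hF, gaussWeight_neg, neg_mul]
  rw [h2, integral_neg] at h
  have h0 : (∫ a : LandauFree H → E3, F a * gaussWeight β H a) = 0 := by linarith
  rw [h0, zero_div]

/-- Even × odd is odd, hence averages to zero. -/
theorem gaussAvg_mul_eq_zero_of_even_odd (β : ℝ) (H : ℕ) {F G : (LandauFree H → E3) → ℝ} (hF : ∀ a, F (-a) = F a) (hG : ∀ a, G (-a) = -G a) :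
    gaussAvg β H (fun a => F a * G a) = 0 :=
  gaussAvg_eq_zero_of_odd β H fun a => by rw [hF, hG, mul_neg]

/-- The Gaussian covariance of an even and an odd observable vanishes. -/
theorem gaussCov_eq_zero_of_even_odd (β : ℝ) (H : ℕ) {F G : (LandauFree H → E3) → ℝ} (hF : ∀ a, F (-a) = F a) (hG : ∀ a, G (-a) = -G a) :
    gaussCov β H F G = 0 := by
  unfold gaussCov
  rw [gaussAvg_mul_eq_zero_of_even_odd β H hF hG, gaussAvg_eq_zero_of_odd β H hG, mul_zero, sub_zero]

/-- `E₀[V₃] = 0`. -/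
theorem gaussAvg_cubicVertex_eq_zero (β : ℝ) (H : ℕ) : gaussAvg β H (cubicVertex β H) = 0 :=
  gaussAvg_eq_zero_of_odd β H (cubicVertex_neg β)

/-- ★ **The 10-leg parity rule of the plan**: `E₀[|ℓ_p|²·|ℓ_q|²·V₃] = 0`. -/
theorem gaussAvg_linCurvSq_mul_linCurvSq_mul_cubicVertex_eq_zero (β : ℝ) (H : ℕ) (p q : Literature.MathematicalPhysics.QuantumFieldTheory.Plaq 4) :
    gaussAvg β H (fun a => linCurvSq H p a * linCurvSq H q a * cubicVertex β H a) = 0 :=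
  gaussAvg_mul_eq_zero_of_even_odd β H (fun a => by rw [linCurvSq_neg, linCurvSq_neg]) (cubicVertex_neg β)

/-- Centred version: `E₀[(|ℓ_p|² − m)(|ℓ_q|² − m′)·V₃] = 0` for any constants. -/
theorem gaussAvg_centred_mul_centred_mul_cubicVertex_eq_zero (β : ℝ) (H : ℕ) (p q : Literature.MathematicalPhysics.QuantumFieldTheory.Plaq 4) (m m' : ℝ) :
    gaussAvg β H (fun a => (linCurvSq H p a - m) * (linCurvSq H q a - m') * cubicVertex β H a) = 0 :=
  gaussAvg_mul_eq_zero_of_even_odd β H (fun a => by rw [linCurvSq_neg, linCurvSq_neg]) (cubicVertex_neg β)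

/-- (e3) of the plan: `Cov₀(|ℓ_p|², c_q^{odd}) = 0`. -/
theorem gaussCov_linCurvSq_chartPlaqCostOdd_eq_zero (β : ℝ) (H : ℕ) (p : Literature.MathematicalPhysics.QuantumFieldTheory.Plaq 4) (x : Site 4) (μ ν : Fin 4) :
    gaussCov β H (linCurvSq H p) (chartPlaqCostOdd H x μ ν) = 0 :=
  gaussCov_eq_zero_of_even_odd β H (linCurvSq_neg p) (chartPlaqCostOdd_neg x μ ν)

/-- Restriction to the (symmetric) small-field set keeps the parity rule: `E₀[1_D·F] = 0` for odd `F`. -/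
theorem gaussAvg_sfInd_mul_eq_zero_of_odd (β : ℝ) (H : ℕ) (s : ℝ) {F : (LandauFree H → E3) → ℝ} (hF : ∀ a, F (-a) = -F a) :
    gaussAvg β H (fun a => sfInd H s a * F a) = 0 :=
  gaussAvg_mul_eq_zero_of_even_odd β H (sfInd_neg s) hF

end EdgeChartGaussian

end Summit.QuantumFields.YangMills.Theorems.AllWindowsColdBoxBoxHighLine

end
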